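import Literature.NumberTheory.EllipticCurves.CPMuDescentK3BoxSplit
import Literature.NumberTheory.EllipticCurves.CPMuDescentK3BoxNodeKill
import HarnessLib

/-!
# The `α̂`-box over `ℚ(√−3)` with one split prime, CUT by the local condition at a killing place: one relation and ONE
# generator (Cohen–Pazuki 2009, Thm. 2.1 with the local condition at a prime `q ∣ s` of the isogenous curve, Prop. 2.2)

Topic `NumberTheory/EllipticCurves`. Sequel of `CPMuDescentK3BoxSplit` (crude box `⟨[ζ], [ϖϖ̄²]⟩` for one split prime `p = ϖϖ̄` in
the support of `2b̂`) and `CPMuDescentK3BoxNodeKill` (the box killed at a place `w₀` with `9 ∤ N(w₀) − 1`). When the crude `K3`-box is the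
`𝔽₃`-plane `⟨[ζ], [ϖϖ̄²]⟩`, the local condition at a node place `w₀` of `Ê₃` (`w₀ ∣ s`, `w₀ ∤ 6Np`, `9 ∤ N(w₀) − 1`) is ONE linear
relation: in the residue field `k(w₀)` the non-cube `ζ̄` generates `k(w₀)ˣ/k(w₀)ˣ³`, so `ϖϖ̄² ≡ ζ^{c₀} y₀³ (mod w₀)` for a unique
`c₀ ∈ ℤ/3` and some `y₀` (a CERTIFICATE, checked per curve), and a Selmer candidate `[ζ^i ϖ^k ϖ̄^l]` (`(k,l) ∈ {(0,0),(1,2),(2,1)}`)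
survives only if `3 ∣ i + c₀ k`. The surviving line is spanned by `[ζ^{e₁} ϖϖ̄²]`, `e₁ ≡ −c₀ (mod 3)` (its square is
`[ζ^{e₂} ϖ²ϖ̄]`, `e₂ ≡ −2c₀`); so ONE descent class of a point of `Ê₃(K3)` on that line books the `K3` side:

* `exists_sub_pow_three_mem_of_eq_cube_mul`, `three_dvd_of_zetaInt_pow_mul_cube_sub_cube_mem` — residue bookkeeping;
* **`torsorClass_eq_zero_of_mem_sha_of_norm_cube_of_gen_splitNodeKill`** — the `K3`-box statement `hbox` of `CPMuDescentBoxes` from: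
  inert `N`, split `p = N(ϖ)`, the valuation conditions off `3Np`, the killing place `w₀` with the certificate `(c₀, y₀)`, and ONE
  generator `[ζ^{e₁} ϖϖ̄²] ∈ G` or `[ζ^{e₂} ϖ²ϖ̄] ∈ G`;
* **`shaCorank_three_eq_zero_of_gens_splitNodeKill`** — `t_3(E_{m,s}) = 0` BOOKED from the `α`-box over `ℚ`, the killing place and one
  `K3`-point: the shape of the rank-2 census curves with `|S| = 2` and one split prime in `b̂` that are not crude-bookable.
Theorems only; no definitions, no named facts.

## References
* [CohenPazuki2009] H. Cohen, F. Pazuki, *Elementary 3-descent with a 3-isogeny*, Acta Arith. 140 (2009), Def. 1.3, Thm. 2.1, Prop. 2.2.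
* [SilvermanAEC2009] J. H. Silverman, *The Arithmetic of Elliptic Curves*, 2nd ed. (2009), Thm. X.4.2 (a), Prop. X.4.9.
* [IrelandRosen1990] K. Ireland, M. Rosen, GTM 84, Ch. 9 §3 (cubic residue character).
-/

noncomputable section

open scoped Classical

open WeierstrassCurve IsDedekindDomain IsDedekindDomain.HeightOneSpectrum NumberField

namespace Literature.NumberTheory.EllipticCurves

namespace CPMuDescent

open MordellDescent ThreeTorsionDescent MuThreeKernel WithZero
open Literature.NumberTheory.NumberFields Literature.NumberTheory.NumberFields.K3

/-! ## Residues: from the completion to `𝓞 K3 / w` -/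

/-- **`x = β³(1 + ε)` in `K3_w` with `x ∈ 𝓞 K3`, `v(ε) < 1` ⟹ `x ≡ y³ (mod w)` for some `y ∈ 𝓞 K3`** (read in `O_w`, then through
the residue map extending `𝓞 K3 → 𝓞 K3 / w`). [cite: SilvermanAEC2009, Prop. X.4.9] -/
theorem exists_sub_pow_three_mem_of_eq_cube_mul (w : HeightOneSpectrum (𝓞 K3)) {x : 𝓞 K3}
    {β ε : w.adicCompletion K3} (hε : Valued.v ε < 1)
    (h : algebraMap K3 (w.adicCompletion K3) (x : K3) = β ^ 3 * (1 + ε)) : ∃ y : 𝓞 K3, x - y ^ 3 ∈ w.asIdeal := by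
  have h1ε : Valued.v (1 + ε) = 1 := Valued.v.map_one_add_of_lt hε
  have hval' : ∀ z : K3, Valued.v (algebraMap K3 (w.adicCompletion K3) z) = w.valuation K3 z :=
    fun z => valuedAdicCompletion_eq_valuation' w z
  have hxv : Valued.v (algebraMap K3 (w.adicCompletion K3) (x : K3)) ≤ 1 := by
    rw [hval']
    exact valuation_le_one w x
  have hβ : Valued.v β ≤ 1 := by
    have e : Valued.v β ^ 3 ≤ 1 := by
      have := hxv
      rw [h, map_mul, map_pow, h1ε, mul_one] at this
      exact this
    rcases lt_or_ge 1 (Valued.v β) with hgt | hle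
    · exact absurd e (not_le.mpr (one_lt_pow₀ hgt three_ne_zero))
    · exact hle
  set O := w.adicCompletionIntegers K3 with hO
  let βO : O := ⟨β, (mem_adicCompletionIntegers (𝓞 K3) K3 w).mpr hβ⟩
  let εO : O := ⟨ε, (mem_adicCompletionIntegers (𝓞 K3) K3 w).mpr hε.le⟩
  let xO : O := algebraMap (𝓞 K3) O x
  have hxO : (xO : w.adicCompletion K3) = algebraMap K3 (w.adicCompletion K3) (x : K3) := by
    rw [Literature.NumberTheory.NumberFields.coe_algebraMap_adicCompletionIntegers_eq K3 w x]
  have hid : xO = βO ^ 3 * (1 + εO) := by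
    apply Subtype.ext
    push_cast
    rw [hxO]
    exact h
  obtain ⟨ρ, hρ, hker⟩ := Literature.NumberTheory.NumberFields.exists_ringHom_adicCompletionIntegers_extending' K3 w
    (Ideal.Quotient.mk w.asIdeal) Ideal.Quotient.mk_surjective Ideal.mk_ker
  have hρε : ρ εO = 0 := (hker εO).mpr hε
  obtain ⟨y, hy⟩ := Ideal.Quotient.mk_surjective (ρ βO)
  refine ⟨y, Ideal.Quotient.eq.mp ?_⟩
  rw [map_pow, hy, ← hρ x, ← map_pow]
  change ρ xO = ρ (βO ^ 3)
  rw [hid, map_mul, map_add, map_one, hρε, add_zero, mul_one]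

/-- `ζ³ = 1` in `𝓞 K3` (private copy). [cite: IrelandRosen1990, Ch. 9 §1] -/
private theorem zetaInt_pow_three' : (zetaInt : 𝓞 K3) ^ 3 = 1 := by
  apply RingOfIntegers.ext
  push_cast [coe_zetaInt]
  exact isPrimitiveRoot_zeta.pow_eq_one

/-- `(ζ − 1)(ζ² − 1) = 3` in `𝓞 K3` (private copy). [cite: IrelandRosen1990, Ch. 9 §1] -/
private theorem zetaInt_sub_one_mul' : (zetaInt - 1) * (zetaInt ^ 2 - 1) = (3 : 𝓞 K3) := by
  apply RingOfIntegers.ext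
  have h3 : ((3 : 𝓞 K3) : K3) = 3 := by simpa using coe_natCast_ringOfIntegers 3
  rw [h3]
  push_cast [coe_zetaInt]
  linear_combination (zeta - 2) * zeta_sq

/-- `ζ^n − 1 ∉ w` for `3 ∤ n` when `3 ∉ w` (private copy). [cite: IrelandRosen1990, Ch. 9 §1] -/
private theorem zetaInt_pow_sub_one_not_mem' {w : HeightOneSpectrum (𝓞 K3)} (h3 : (3 : 𝓞 K3) ∉ w.asIdeal)
    {n : ℕ} (hn : ¬ 3 ∣ n) : zetaInt ^ n - 1 ∉ w.asIdeal := by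
  have hmod : zetaInt ^ n = zetaInt ^ (n % 3) := by
    conv_lhs => rw [← Nat.div_add_mod n 3, pow_add, pow_mul, zetaInt_pow_three', one_pow, one_mul]
  rw [hmod]
  intro hmem
  apply h3
  rw [← zetaInt_sub_one_mul']
  have hn' : n % 3 = 1 ∨ n % 3 = 2 := by omega
  rcases hn' with h1 | h2
  · rw [h1, pow_one] at hmem
    exact w.asIdeal.mul_mem_right _ hmem
  · rw [h2] at hmem
    exact w.asIdeal.mul_mem_left _ hmem

/-- **`ζ^n t³ ≡ s³ (mod w)` with `t ∉ w` forces `3 ∣ n`** when `3 ∉ w` and `9 ∤ N(w) − 1` (else the class of `s/t` has order `9` in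
`k(w)ˣ`). [cite: IrelandRosen1990, Ch. 9 §3 (cubic residue character)] -/
theorem three_dvd_of_zetaInt_pow_mul_cube_sub_cube_mem {w : HeightOneSpectrum (𝓞 K3)} (h3 : (3 : 𝓞 K3) ∉ w.asIdeal)
    (h9 : ¬ 9 ∣ Ideal.absNorm w.asIdeal - 1) {n : ℕ} {t s : 𝓞 K3} (ht : t ∉ w.asIdeal)
    (h : zetaInt ^ n * t ^ 3 - s ^ 3 ∈ w.asIdeal) : 3 ∣ n := by
  by_contra hn
  apply h9
  haveI : w.asIdeal.IsMaximal := w.isMaximal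
  letI : Field (𝓞 K3 ⧸ w.asIdeal) := Ideal.Quotient.field w.asIdeal
  haveI : Finite (𝓞 K3 ⧸ w.asIdeal) := Ideal.finiteQuotientOfFreeOfNeBot w.asIdeal w.ne_bot
  letI : Fintype (𝓞 K3 ⧸ w.asIdeal) := Fintype.ofFinite _
  have hcard : Ideal.absNorm w.asIdeal = Fintype.card (𝓞 K3 ⧸ w.asIdeal) := by
    rw [Ideal.absNorm_apply, Submodule.cardQuot_apply, Nat.card_eq_fintype_card]
  rw [hcard]
  set π := Ideal.Quotient.mk w.asIdeal with hπ
  have ht0 : π t ≠ 0 := by rwa [ne_eq, Ideal.Quotient.eq_zero_iff_mem]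
  have hrel : π zetaInt ^ n * π t ^ 3 = π s ^ 3 := by
    have := (Ideal.Quotient.eq (I := w.asIdeal)).mpr h
    simpa [map_mul, map_pow] using this
  refine nine_dvd_card_sub_one_of_pow_three_eq (g := π zetaInt ^ n) (c := π s / π t) ?_ ?_ ?_
  · rw [← pow_mul, mul_comm, pow_mul, ← map_pow, zetaInt_pow_three', map_one, one_pow]
  · intro h1
    rw [← map_pow, ← map_one π, Ideal.Quotient.eq] at h1
    exact zetaInt_pow_sub_one_not_mem' h3 hn h1
  · rw [div_pow, div_eq_iff (pow_ne_zero 3 ht0), ← hrel]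

/-! ## The `K3`-box with one split prime, cut at a killing place: one generator -/

/-- `[ζ^i x] ∈ G` from `[ζ^j x] ∈ G` when `i = j` after reduction mod 3 (bookkeeping, private). [cite: CohenPazuki2009, Def. 1.3] -/
private theorem cubeClass_zeta_pow_mul_eq {i j : ℕ} (hij : i % 3 = j % 3) (x : K3) :
    cubeClass ((zeta : K3) ^ i * x) = cubeClass ((zeta : K3) ^ j * x) := by
  have hz : (zeta : K3) ≠ 0 := isPrimitiveRoot_zeta.ne_zero (by norm_num)
  have key : ∀ n : ℕ, cubeClass ((zeta : K3) ^ n * x) = cubeClass ((zeta : K3) ^ (n % 3) * x) := by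
    intro n
    conv_lhs => rw [← Nat.div_add_mod n 3, pow_add, pow_mul, isPrimitiveRoot_zeta.pow_eq_one, one_pow, one_mul]
  rw [key i, key j, hij]

/-- **The `α̂`-box over `K3` with one split prime and a killing place: ONE generator.** For a Cohen–Pazuki pair
`cpCurve a₃ b₃ → threeTorsionModel m₃ s₃` over `K3`, `N ≠ 0` with inert prime factors, a split prime `p = ϖϖ̄ ≡ 1 (3)` (`ϖ = a + bζ`),
`w(2s₃) = 1`, `w(2m₃) ≤ 1` off `3Np`; a killing place `w₀ ∌ 3Np` with `w₀(2) = 1`, `w₀(s₃) = 1`, `w₀(27s₃ − 4m₃³) < 1`, `9 ∤ N(w₀) − 1`, and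
a residue certificate `ϖϖ̄² ≡ ζ^{c₀} y₀³ (mod w₀)`; and ONE generator `[ζ^{e₁} ϖϖ̄²] ∈ G` or `[ζ^{e₂} ϖ²ϖ̄] ∈ G` with `3 ∣ e₁ + c₀`,
`3 ∣ e₂ + 2c₀`, `G = ⟨[α̂(P)] : P ∈ Ê₃(K3)⟩`: every `μ₃`-torsor class `[C_u]`, `u` of cube norm, lying in `Ш(V₃/K3)` vanishes.
[cite: CohenPazuki2009, Theorem 2.1 and Proposition 2.2] [cite: SilvermanAEC2009, Prop. X.4.9] -/
theorem torsorClass_eq_zero_of_mem_sha_of_norm_cube_of_gen_splitNodeKill {N : ℕ} (hN0 : N ≠ 0)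
    (hN : ∀ q ∈ N.primeFactors, q = 2 ∨ q % 3 = 2) {p : ℕ} (hp : p.Prime) (hp1 : p % 3 = 1) {a b : ℤ}
    (hab : a ^ 2 - a * b + b ^ 2 = p) {a₃ b₃ t m₃ s₃ : K3} (hb₃ : b₃ ≠ 0)
    (hd₃ : 4 * a₃ ^ 3 + 9 * b₃ ≠ 0) (ht : t ≠ 0) (hm₃ : t * m₃ = 3 * a₃) (hs₃ : t ^ 3 * s₃ = 4 * a₃ ^ 3 + 9 * b₃)
    (hvs : ∀ w : HeightOneSpectrum (𝓞 K3), ((3 * N * p : ℕ) : 𝓞 K3) ∉ w.asIdeal → w.valuation K3 (2 * s₃) = 1)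
    (hvm : ∀ w : HeightOneSpectrum (𝓞 K3), ((3 * N * p : ℕ) : 𝓞 K3) ∉ w.asIdeal → w.valuation K3 (2 * m₃) ≤ 1)
    (w₀ : HeightOneSpectrum (𝓞 K3)) (hw₀ : ((3 * N * p : ℕ) : 𝓞 K3) ∉ w₀.asIdeal) (hw₀2 : w₀.valuation K3 2 = 1)
    (hw₀s : w₀.valuation K3 s₃ = 1) (hw₀D : w₀.valuation K3 (27 * s₃ - 4 * m₃ ^ 3) < 1)
    (hw₀9 : ¬ 9 ∣ Ideal.absNorm w₀.asIdeal - 1)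
    {c₀ : ℕ} {y₀ : 𝓞 K3} (hcert : mkInt a b * mkInt (a - b) (-b) ^ 2 - zetaInt ^ c₀ * y₀ ^ 3 ∈ w₀.asIdeal)
    {e₁ e₂ : ℕ} (he₁ : 3 ∣ e₁ + c₀) (he₂ : 3 ∣ e₂ + 2 * c₀)
    (hgenϖ : cubeClass ((zeta : K3) ^ e₁ * ((⟨a, b⟩ : K3) * (⟨a - b, -b⟩ : K3) ^ 2)) ∈ Subgroup.closure (Set.range
        fun P : (threeTorsionModel m₃ s₃).toAffine.Point => descentClass (threeTorsionModel m₃ s₃) m₃ s₃ P) ∨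
      cubeClass ((zeta : K3) ^ e₂ * ((⟨a, b⟩ : K3) ^ 2 * (⟨a - b, -b⟩ : K3))) ∈ Subgroup.closure (Set.range
        fun P : (threeTorsionModel m₃ s₃).toAffine.Point => descentClass (threeTorsionModel m₃ s₃) m₃ s₃ P))
    {u : K3} (hu : u ≠ 0) (hsha : (kernelDatum hb₃ hd₃).torsorClass hu ∈ (cpCurve a₃ b₃).sha)
    (hnorm : ∃ r : ℚ, QuadraticAlgebra.norm u = r ^ 3) : (kernelDatum hb₃ hd₃).torsorClass hu = 0 := by
  set G := Subgroup.closure (Set.range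
      fun P : (threeTorsionModel m₃ s₃).toAffine.Point => descentClass (threeTorsionModel m₃ s₃) m₃ s₃ P) with hG
  have hval : ∀ w : HeightOneSpectrum (𝓞 K3), ((3 * N * p : ℕ) : 𝓞 K3) ∉ w.asIdeal →
      (3 : ℤ) ∣ log (w.valuation K3 u) := by
    intro w hw
    obtain ⟨P, w', e, hw', hP⟩ :=
      exists_descent_pow_eq_adicCompletion_of_torsorClass_mem_sha hb₃ hd₃ ht hm₃ hs₃ hu hsha w
    have hval' : ∀ x : K3, Valued.v (algebraMap K3 (w.adicCompletion K3) x) = w.valuation K3 x :=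
      fun x => valuedAdicCompletion_eq_valuation' w x
    have key := Carrier6137.three_dvd_log_of_descent_pow_eq' Valued.v (algebraMap K3 (w.adicCompletion K3))
      (by rw [hval']; exact hvs w hw) (by rw [hval']; exact hvm w hw) hu hw' hP
    rwa [hval'] at key
  obtain ⟨i, k, l, hi3, -, -, hkl, hi⟩ := K3.exists_cubeClass_eq_of_norm_cube_split hN0 hN hp hp1 hab hu hval hnorm
  have hz : (zeta : K3) ≠ 0 := isPrimitiveRoot_zeta.ne_zero (by norm_num)
  have hp0 : (p : ℤ) ≠ 0 := by exact_mod_cast hp.ne_zero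
  have hϖ : (⟨a, b⟩ : K3) ≠ 0 := fun h0 => by
    have ha : (a : ℚ) = 0 := congrArg QuadraticAlgebra.re h0
    have hb : (b : ℚ) = 0 := congrArg QuadraticAlgebra.im h0
    have ha' : a = 0 := by exact_mod_cast ha
    have hb' : b = 0 := by exact_mod_cast hb
    subst ha'; subst hb'
    exact hp0 (by rw [← hab]; ring)
  have hϖ' : (⟨a - b, -b⟩ : K3) ≠ 0 := fun h0 => by
    have ha : (a : ℚ) - b = 0 := congrArg QuadraticAlgebra.re h0
    have hb : -(b : ℚ) = 0 := congrArg QuadraticAlgebra.im h0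
    have hb' : b = 0 := by exact_mod_cast (neg_eq_zero.mp hb)
    subst hb'
    have ha' : a = 0 := by exact_mod_cast (show (a : ℚ) = 0 by simpa using ha)
    subst ha'
    exact hp0 (by rw [← hab]; ring)
  have hw₀3 : (3 : 𝓞 K3) ∉ w₀.asIdeal := fun h => hw₀ (by
    rw [Nat.cast_mul, Nat.cast_mul, Nat.cast_ofNat, mul_assoc]; exact w₀.asIdeal.mul_mem_right _ h)
  have hw₀p : ((p : ℕ) : 𝓞 K3) ∉ w₀.asIdeal := fun h => hw₀ (by
    rw [Nat.cast_mul]; exact w₀.asIdeal.mul_mem_left _ h)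
  have hxInt : ((mkInt a b : 𝓞 K3) : K3) = (⟨a, b⟩ : K3) := coe_mkInt a b
  have hxInt' : ((mkInt (a - b) (-b) : 𝓞 K3) : K3) = (⟨a - b, -b⟩ : K3) := by
    rw [coe_mkInt]; push_cast; rfl
  obtain ⟨r, hr, hur⟩ := (cubeClass_eq_cubeClass_iff hu (mul_ne_zero (mul_ne_zero (pow_ne_zero i hz)
    (pow_ne_zero k hϖ)) (pow_ne_zero l hϖ'))).mp hi
  set L := w₀.adicCompletion K3 with hL
  set φ := algebraMap K3 L with hφ
  have hvalL : ∀ x : K3, Valued.v (φ x) = w₀.valuation K3 x := fun x => valuedAdicCompletion_eq_valuation' w₀ x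
  obtain ⟨P, w', e, hw', hP⟩ :=
    exists_descent_pow_eq_adicCompletion_of_torsorClass_mem_sha hb₃ hd₃ ht hm₃ hs₃ hu hsha w₀
  have h3' : w₀.valuation K3 (3 : K3) = 1 := by
    have h33 : ((3 : 𝓞 K3) : K3) = 3 := by simpa using coe_natCast_ringOfIntegers 3
    rw [← h33]; exact K3.valuation_coe_eq_one w₀ hw₀3
  have h2L : Valued.v (2 : L) = 1 := by rw [← map_ofNat φ 2, hvalL]; exact hw₀2
  have h3L : Valued.v (3 : L) = 1 := by rw [← map_ofNat φ 3, hvalL]; exact h3'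
  have hsL : Valued.v (φ s₃) = 1 := by rw [hvalL]; exact hw₀s
  have hDL : Valued.v (27 * φ s₃ - 4 * φ m₃ ^ 3) < 1 := by
    rw [show (27 : L) * φ s₃ - 4 * φ m₃ ^ 3 = φ (27 * s₃ - 4 * m₃ ^ 3) by
      rw [map_sub, map_mul, map_mul, map_pow, map_ofNat, map_ofNat], hvalL]
    exact hw₀D
  obtain ⟨c, ε, -, hε, huc⟩ := (Valued.v : Valuation L ℤᵐ⁰).eq_cube_mul_one_add_of_threeTorsionDescent_pow_eq
    (W := threeTorsionModel (φ m₃) (φ s₃)) rfl h2L h3L hsL hDL hw' hP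
  have hr' : φ r ≠ 0 := (map_ne_zero φ).mpr hr
  set xInt : 𝓞 K3 := zetaInt ^ i * mkInt a b ^ k * mkInt (a - b) (-b) ^ l with hxdef
  have hxK : (xInt : K3) = (zeta : K3) ^ i * (⟨a, b⟩ : K3) ^ k * (⟨a - b, -b⟩ : K3) ^ l := by
    rw [hxdef]; push_cast [coe_zetaInt, hxInt, hxInt']; ring
  have hxL : φ (xInt : K3) = (c / φ r) ^ 3 * (1 + ε) := by
    rw [hur, map_mul, map_pow] at huc
    rw [hxK, div_pow, div_mul_eq_mul_div, eq_div_iff (pow_ne_zero 3 hr')]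
    linear_combination huc
  obtain ⟨y, hy⟩ := exists_sub_pow_three_mem_of_eq_cube_mul w₀ hε hxL
  have hy₀ : y₀ ∉ w₀.asIdeal := by
    intro hmem
    have h1 : mkInt a b * mkInt (a - b) (-b) ^ 2 ∈ w₀.asIdeal := by
      have : zetaInt ^ c₀ * y₀ ^ 3 ∈ w₀.asIdeal := w₀.asIdeal.mul_mem_left _ (w₀.asIdeal.pow_mem_of_mem hmem 3 (by norm_num))
      simpa using w₀.asIdeal.add_mem hcert this
    have h2 : ((p : ℕ) : 𝓞 K3) ^ 2 ∈ w₀.asIdeal := by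
      have e : ((p : ℕ) : 𝓞 K3) ^ 2 = (mkInt a b * mkInt (a - b) (-b) ^ 2) * mkInt a b := by
        rw [show ((p : ℕ) : 𝓞 K3) = mkInt a b * mkInt (a - b) (-b) by rw [mkInt_mul_conj, hab, Int.cast_natCast]]; ring
      rw [e]; exact w₀.asIdeal.mul_mem_right _ h1
    exact hw₀p (w₀.isPrime.mem_of_pow_mem 2 h2)
  have hϖmem : ∀ n : ℕ, mkInt a b ^ n ∉ w₀.asIdeal := fun n h => hw₀p (by
    have := w₀.isPrime.mem_of_pow_mem n h
    rw [show ((p : ℕ) : 𝓞 K3) = mkInt a b * mkInt (a - b) (-b) by rw [mkInt_mul_conj, hab, Int.cast_natCast]]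
    exact w₀.asIdeal.mul_mem_right _ this)
  have hϖ'mem : ∀ n : ℕ, mkInt (a - b) (-b) ^ n ∉ w₀.asIdeal := fun n h => hw₀p (by
    have := w₀.isPrime.mem_of_pow_mem n h
    rw [show ((p : ℕ) : 𝓞 K3) = mkInt a b * mkInt (a - b) (-b) by rw [mkInt_mul_conj, hab, Int.cast_natCast]]
    exact w₀.asIdeal.mul_mem_left _ this)
  rw [(kernelDatum hb₃ hd₃).torsorClass_eq_zero_iff_cubeClass_mem_ker hu, hi, MonoidHom.mem_ker]
  refine torsorClassQuotHom_eq_one_of_mem_closure hb₃ hd₃ ht hm₃ hs₃ ?_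
  rcases hkl with ⟨rfl, rfl⟩ | ⟨rfl, rfl⟩ | ⟨rfl, rfl⟩
  · -- `(0,0)`: `ζ^i ≡ y³` forces `3 ∣ i`, class trivial
    have h3i : 3 ∣ i := three_dvd_of_zetaInt_pow_mul_cube_sub_cube_mem hw₀3 hw₀9 (t := 1) (s := y)
      (fun h => w₀.isPrime.ne_top ((Ideal.eq_top_iff_one _).mpr h)) (by simpa [hxdef] using hy)
    obtain ⟨d, rfl⟩ := h3i
    rw [pow_zero, pow_zero, mul_one, mul_one, pow_mul, isPrimitiveRoot_zeta.pow_eq_one, one_pow, cubeClass_one]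
    exact G.one_mem
  · -- `(1,2)`: `ζ^{i+c₀} y₀³ ≡ y³` forces `3 ∣ i + c₀`, so `[u] = [ζ^{e₁} ϖϖ̄²]`
    have hrel : zetaInt ^ (i + c₀) * y₀ ^ 3 - y ^ 3 ∈ w₀.asIdeal := by
      have e : zetaInt ^ (i + c₀) * y₀ ^ 3 - y ^ 3 =
          (xInt - y ^ 3) - zetaInt ^ i * (mkInt a b * mkInt (a - b) (-b) ^ 2 - zetaInt ^ c₀ * y₀ ^ 3) := by
        rw [hxdef]; ring
      rw [e]; exact w₀.asIdeal.sub_mem hy (w₀.asIdeal.mul_mem_left _ hcert)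
    have h3 : 3 ∣ i + c₀ := three_dvd_of_zetaInt_pow_mul_cube_sub_cube_mem hw₀3 hw₀9 hy₀ hrel
    have hx12 : (⟨a, b⟩ : K3) * (⟨a - b, -b⟩ : K3) ^ 2 ≠ 0 := mul_ne_zero hϖ (pow_ne_zero _ hϖ')
    have hx21 : (⟨a, b⟩ : K3) ^ 2 * (⟨a - b, -b⟩ : K3) ≠ 0 := mul_ne_zero (pow_ne_zero _ hϖ) hϖ'
    have hcl : cubeClass ((zeta : K3) ^ i * (⟨a, b⟩ : K3) ^ 1 * (⟨a - b, -b⟩ : K3) ^ 2) =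
        cubeClass ((zeta : K3) ^ e₁ * ((⟨a, b⟩ : K3) * (⟨a - b, -b⟩ : K3) ^ 2)) := by
      rw [pow_one, mul_assoc]
      exact cubeClass_zeta_pow_mul_eq (by omega) _
    rw [hcl]
    rcases hgenϖ with h | h
    · exact h
    · -- the square of `[ζ^{e₂} ϖ²ϖ̄]` is `[ζ^{2e₂} ϖ ϖ̄²]`, and `2e₂ ≡ e₁`
      have hsq : cubeClass ((zeta : K3) ^ e₁ * ((⟨a, b⟩ : K3) * (⟨a - b, -b⟩ : K3) ^ 2)) =
          cubeClass ((zeta : K3) ^ e₂ * ((⟨a, b⟩ : K3) ^ 2 * (⟨a - b, -b⟩ : K3))) *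
            cubeClass ((zeta : K3) ^ e₂ * ((⟨a, b⟩ : K3) ^ 2 * (⟨a - b, -b⟩ : K3))) := by
        rw [← cubeClass_mul (mul_ne_zero (pow_ne_zero _ hz) hx21) (mul_ne_zero (pow_ne_zero _ hz) hx21),
          show (zeta : K3) ^ e₂ * ((⟨a, b⟩ : K3) ^ 2 * (⟨a - b, -b⟩ : K3)) *
            ((zeta : K3) ^ e₂ * ((⟨a, b⟩ : K3) ^ 2 * (⟨a - b, -b⟩ : K3))) =
            (zeta : K3) ^ (2 * e₂) * ((⟨a, b⟩ : K3) * (⟨a - b, -b⟩ : K3) ^ 2) * (⟨a, b⟩ : K3) ^ 3 by ring,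
          cubeClass_mul_pow_three (mul_ne_zero (pow_ne_zero _ hz) hx12) hϖ]
        exact cubeClass_zeta_pow_mul_eq (by omega) _
      rw [hsq]; exact G.mul_mem h h
  · -- `(2,1)`: `ϖ²ϖ̄ · ϖ̄³ = (ϖϖ̄²)²`, so `ζ^{i+2c₀} (y₀²)³ ≡ (y ϖ̄)³` forces `3 ∣ i + 2c₀`, `[u] = [ζ^{e₂} ϖ²ϖ̄]`
    have hrel : zetaInt ^ (i + 2 * c₀) * (y₀ ^ 2) ^ 3 - (y * mkInt (a - b) (-b)) ^ 3 ∈ w₀.asIdeal := by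
      have e : zetaInt ^ (i + 2 * c₀) * (y₀ ^ 2) ^ 3 - (y * mkInt (a - b) (-b)) ^ 3 =
          (xInt - y ^ 3) * mkInt (a - b) (-b) ^ 3 -
            zetaInt ^ i * (mkInt a b * mkInt (a - b) (-b) ^ 2 + zetaInt ^ c₀ * y₀ ^ 3) *
              (mkInt a b * mkInt (a - b) (-b) ^ 2 - zetaInt ^ c₀ * y₀ ^ 3) := by
        rw [hxdef]; ring
      rw [e]
      exact w₀.asIdeal.sub_mem (w₀.asIdeal.mul_mem_right _ hy) (w₀.asIdeal.mul_mem_left _ hcert)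
    have hy₀2 : y₀ ^ 2 ∉ w₀.asIdeal := fun h => hy₀ (w₀.isPrime.mem_of_pow_mem 2 h)
    have h3 : 3 ∣ i + 2 * c₀ := three_dvd_of_zetaInt_pow_mul_cube_sub_cube_mem hw₀3 hw₀9 hy₀2 hrel
    have hx12 : (⟨a, b⟩ : K3) * (⟨a - b, -b⟩ : K3) ^ 2 ≠ 0 := mul_ne_zero hϖ (pow_ne_zero _ hϖ')
    have hx21 : (⟨a, b⟩ : K3) ^ 2 * (⟨a - b, -b⟩ : K3) ≠ 0 := mul_ne_zero (pow_ne_zero _ hϖ) hϖ'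
    have hcl : cubeClass ((zeta : K3) ^ i * (⟨a, b⟩ : K3) ^ 2 * (⟨a - b, -b⟩ : K3) ^ 1) =
        cubeClass ((zeta : K3) ^ e₂ * ((⟨a, b⟩ : K3) ^ 2 * (⟨a - b, -b⟩ : K3))) := by
      rw [pow_one, mul_assoc]
      exact cubeClass_zeta_pow_mul_eq (by omega) _
    rw [hcl]
    rcases hgenϖ with h | h
    · -- the square of `[ζ^{e₁} ϖϖ̄²]` is `[ζ^{2e₁} ϖ² ϖ̄]`, and `2e₁ ≡ e₂`
      have hsq : cubeClass ((zeta : K3) ^ e₂ * ((⟨a, b⟩ : K3) ^ 2 * (⟨a - b, -b⟩ : K3))) =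
          cubeClass ((zeta : K3) ^ e₁ * ((⟨a, b⟩ : K3) * (⟨a - b, -b⟩ : K3) ^ 2)) *
            cubeClass ((zeta : K3) ^ e₁ * ((⟨a, b⟩ : K3) * (⟨a - b, -b⟩ : K3) ^ 2)) := by
        rw [← cubeClass_mul (mul_ne_zero (pow_ne_zero _ hz) hx12) (mul_ne_zero (pow_ne_zero _ hz) hx12),
          show (zeta : K3) ^ e₁ * ((⟨a, b⟩ : K3) * (⟨a - b, -b⟩ : K3) ^ 2) *
            ((zeta : K3) ^ e₁ * ((⟨a, b⟩ : K3) * (⟨a - b, -b⟩ : K3) ^ 2)) =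
            (zeta : K3) ^ (2 * e₁) * ((⟨a, b⟩ : K3) ^ 2 * (⟨a - b, -b⟩ : K3)) * (⟨a - b, -b⟩ : K3) ^ 3 by ring,
          cubeClass_mul_pow_three (mul_ne_zero (pow_ne_zero _ hz) hx21) hϖ']
        exact cubeClass_zeta_pow_mul_eq (by omega) _
      rw [hsq]; exact G.mul_mem h h
    · exact h

/-! ## Booking a cross-prime cell at `3`: `α`-box over `ℚ`, one split prime in `b̂`, a killing place, ONE `K3`-point -/

/-- `((3 * N * p : ℕ)) ∉ w ⇒ ((3 * (N * p) : ℕ)) ∉ w` (reassociation, private). [cite: CohenPazuki2009, Theorem 2.1 (2)] -/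
private theorem not_mem_assoc' {N p : ℕ} {w : HeightOneSpectrum (𝓞 K3)} (hw : ((3 * N * p : ℕ) : 𝓞 K3) ∉ w.asIdeal) :
    ((3 * (N * p) : ℕ) : 𝓞 K3) ∉ w.asIdeal := by
  rwa [← mul_assoc]

/-- **`Ш(E/ℚ)[3] = 0` for `E = threeTorsionModel m s`, one split prime in `b̂`, with the local condition at a killing place `w₀ ∣ s`**
(`α`-box over `ℚ` from `S`; inert `N`, split `p = N(a + bζ)`; `w₀ ∌ 3Np`, `w₀(2) = 1`, `w₀(s) < 1`, `9 ∤ N(w₀) − 1`; certificate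
`ϖϖ̄² ≡ ζ^{c₀} y₀³ (mod w₀)`; ONE descent class `[ζ^{e₁} ϖϖ̄²]` or `[ζ^{e₂} ϖ²ϖ̄]` per sign of `θ₀`).
[cite: CohenPazuki2009, Theorem 2.1 and Proposition 2.2] [cite: SilvermanAEC2009, Thm. X.4.2 (a)] -/
theorem forall_mem_sha_three_nsmul_eq_zero_of_gens_splitNodeKill {m s : ℚ} [(threeTorsionModel m s).IsElliptic]
    (S : Finset ℕ) (hS : ∀ q ∈ S, q.Prime)
    (hout : ∀ q : ℕ, q.Prime → q ∉ S → padicValRat q (2 * s) = 0 ∧ 0 ≤ padicValRat q (2 * m))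
    (hgen : ∀ q ∈ S, cubeClass (q : ℚ) ∈ Subgroup.closure (Set.range
      fun P : (threeTorsionModel m s).toAffine.Point => descentClass (threeTorsionModel m s) m s P))
    {N : ℕ} (hN0 : N ≠ 0) (hN : ∀ q ∈ N.primeFactors, q = 2 ∨ q % 3 = 2)
    {p : ℕ} (hp : p.Prime) (hp1 : p % 3 = 1) {a b : ℤ} (hab : a ^ 2 - a * b + b ^ 2 = p)
    (hvb : ∀ w : HeightOneSpectrum (𝓞 K3), ((3 * N * p : ℕ) : 𝓞 K3) ∉ w.asIdeal →
      w.valuation K3 (algebraMap ℚ K3 (2 * (3 * s - 4 * m ^ 3 / 9))) = 1)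
    (hvm : ∀ w : HeightOneSpectrum (𝓞 K3), ((3 * N * p : ℕ) : 𝓞 K3) ∉ w.asIdeal →
      w.valuation K3 (algebraMap ℚ K3 (2 * m)) ≤ 1)
    (w₀ : HeightOneSpectrum (𝓞 K3)) (hw₀ : ((3 * N * p : ℕ) : 𝓞 K3) ∉ w₀.asIdeal) (hw₀2 : w₀.valuation K3 2 = 1)
    (hw₀s : w₀.valuation K3 (algebraMap ℚ K3 s) < 1) (hw₀9 : ¬ 9 ∣ Ideal.absNorm w₀.asIdeal - 1)
    {c₀ : ℕ} {y₀ : 𝓞 K3} (hcert : mkInt a b * mkInt (a - b) (-b) ^ 2 - zetaInt ^ c₀ * y₀ ^ 3 ∈ w₀.asIdeal)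
    {e₁ e₂ : ℕ} (he₁ : 3 ∣ e₁ + c₀) (he₂ : 3 ∣ e₂ + 2 * c₀)
    (hgen₃ : ∀ θ₀ : K3, θ₀ ^ 2 = -3 →
      cubeClass ((zeta : K3) ^ e₁ * ((⟨a, b⟩ : K3) * (⟨a - b, -b⟩ : K3) ^ 2)) ∈ Subgroup.closure (Set.range
        fun P : (threeTorsionModel (algebraMap ℚ K3 m * θ₀) (algebraMap ℚ K3 (3 * s - 4 * m ^ 3 / 9) * θ₀)).toAffine.Point =>
          descentClass (threeTorsionModel (algebraMap ℚ K3 m * θ₀) (algebraMap ℚ K3 (3 * s - 4 * m ^ 3 / 9) * θ₀))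
            (algebraMap ℚ K3 m * θ₀) (algebraMap ℚ K3 (3 * s - 4 * m ^ 3 / 9) * θ₀) P) ∨
      cubeClass ((zeta : K3) ^ e₂ * ((⟨a, b⟩ : K3) ^ 2 * (⟨a - b, -b⟩ : K3))) ∈ Subgroup.closure (Set.range
        fun P : (threeTorsionModel (algebraMap ℚ K3 m * θ₀) (algebraMap ℚ K3 (3 * s - 4 * m ^ 3 / 9) * θ₀)).toAffine.Point =>
          descentClass (threeTorsionModel (algebraMap ℚ K3 m * θ₀) (algebraMap ℚ K3 (3 * s - 4 * m ^ 3 / 9) * θ₀))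
            (algebraMap ℚ K3 m * θ₀) (algebraMap ℚ K3 (3 * s - 4 * m ^ 3 / 9) * θ₀) P)) :
    ∀ c ∈ (threeTorsionModel m s).sha, 3 • c = 0 → c = 0 :=
  forall_mem_sha_three_nsmul_eq_zero_of_gens_of_box S hS hout hgen
    (fun θ₀ => -(algebraMap ℚ K3 m / 3) * θ₀) (fun θ₀ => -(algebraMap ℚ K3 s / 3) * θ₀)
    (fun _ hθ => canonical₃_b_ne_zero (m := m) hθ) (fun _ hθ => canonical₃_d_ne_zero hθ)
    (fun _ hθ => canonical₃_baseChange_eq hθ) (fun _ hθ => canonical₃_hy hθ)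
    (fun θ₀ hθ _ hu hsha hnorm => torsorClass_eq_zero_of_mem_sha_of_norm_cube_of_gen_splitNodeKill hN0 hN hp hp1 hab
      (canonical₃_b_ne_zero (m := m) hθ) (canonical₃_d_ne_zero hθ) (t := -1) (by norm_num) canonical₃_hm
      (canonical₃_hs hθ) (fun w hw => canonical₃_valuation_s hθ (not_mem_assoc' hw) (hvb w hw))
      (fun w hw => canonical₃_valuation_m hθ (not_mem_assoc' hw) (hvm w hw)) w₀ hw₀ hw₀2
      (canonical₃_valuation_s₃ hθ (not_mem_assoc' hw₀) hw₀2 (hvb w₀ hw₀))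
      (canonical₃_valuation_D hθ (not_mem_assoc' hw₀) hw₀s) hw₀9 hcert he₁ he₂ (hgen₃ θ₀ hθ) hu hsha hnorm)

/-- **`t_3(E_{m,s}) = corank_{ℤ₃} Ш(E/ℚ)[3^∞] = 0` BOOKED from the `α`-box over `ℚ`, one split prime with a residue certificate at a
killing place, and ONE `K3`-point.** [cite: CohenPazuki2009, Proposition 2.2] [cite: SilvermanAEC2009, Thm. X.4.2 (a)] -/
theorem shaCorank_three_eq_zero_of_gens_splitNodeKill {m s : ℚ} [(threeTorsionModel m s).IsElliptic]
    (S : Finset ℕ) (hS : ∀ q ∈ S, q.Prime)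
    (hout : ∀ q : ℕ, q.Prime → q ∉ S → padicValRat q (2 * s) = 0 ∧ 0 ≤ padicValRat q (2 * m))
    (hgen : ∀ q ∈ S, cubeClass (q : ℚ) ∈ Subgroup.closure (Set.range
      fun P : (threeTorsionModel m s).toAffine.Point => descentClass (threeTorsionModel m s) m s P))
    {N : ℕ} (hN0 : N ≠ 0) (hN : ∀ q ∈ N.primeFactors, q = 2 ∨ q % 3 = 2)
    {p : ℕ} (hp : p.Prime) (hp1 : p % 3 = 1) {a b : ℤ} (hab : a ^ 2 - a * b + b ^ 2 = p)
    (hvb : ∀ w : HeightOneSpectrum (𝓞 K3), ((3 * N * p : ℕ) : 𝓞 K3) ∉ w.asIdeal →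
      w.valuation K3 (algebraMap ℚ K3 (2 * (3 * s - 4 * m ^ 3 / 9))) = 1)
    (hvm : ∀ w : HeightOneSpectrum (𝓞 K3), ((3 * N * p : ℕ) : 𝓞 K3) ∉ w.asIdeal →
      w.valuation K3 (algebraMap ℚ K3 (2 * m)) ≤ 1)
    (w₀ : HeightOneSpectrum (𝓞 K3)) (hw₀ : ((3 * N * p : ℕ) : 𝓞 K3) ∉ w₀.asIdeal) (hw₀2 : w₀.valuation K3 2 = 1)
    (hw₀s : w₀.valuation K3 (algebraMap ℚ K3 s) < 1) (hw₀9 : ¬ 9 ∣ Ideal.absNorm w₀.asIdeal - 1)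
    {c₀ : ℕ} {y₀ : 𝓞 K3} (hcert : mkInt a b * mkInt (a - b) (-b) ^ 2 - zetaInt ^ c₀ * y₀ ^ 3 ∈ w₀.asIdeal)
    {e₁ e₂ : ℕ} (he₁ : 3 ∣ e₁ + c₀) (he₂ : 3 ∣ e₂ + 2 * c₀)
    (hgen₃ : ∀ θ₀ : K3, θ₀ ^ 2 = -3 →
      cubeClass ((zeta : K3) ^ e₁ * ((⟨a, b⟩ : K3) * (⟨a - b, -b⟩ : K3) ^ 2)) ∈ Subgroup.closure (Set.range
        fun P : (threeTorsionModel (algebraMap ℚ K3 m * θ₀) (algebraMap ℚ K3 (3 * s - 4 * m ^ 3 / 9) * θ₀)).toAffine.Point =>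
          descentClass (threeTorsionModel (algebraMap ℚ K3 m * θ₀) (algebraMap ℚ K3 (3 * s - 4 * m ^ 3 / 9) * θ₀))
            (algebraMap ℚ K3 m * θ₀) (algebraMap ℚ K3 (3 * s - 4 * m ^ 3 / 9) * θ₀) P) ∨
      cubeClass ((zeta : K3) ^ e₂ * ((⟨a, b⟩ : K3) ^ 2 * (⟨a - b, -b⟩ : K3))) ∈ Subgroup.closure (Set.range
        fun P : (threeTorsionModel (algebraMap ℚ K3 m * θ₀) (algebraMap ℚ K3 (3 * s - 4 * m ^ 3 / 9) * θ₀)).toAffine.Point =>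
          descentClass (threeTorsionModel (algebraMap ℚ K3 m * θ₀) (algebraMap ℚ K3 (3 * s - 4 * m ^ 3 / 9) * θ₀))
            (algebraMap ℚ K3 m * θ₀) (algebraMap ℚ K3 (3 * s - 4 * m ^ 3 / 9) * θ₀) P)) :
    (threeTorsionModel m s).shaCorank 3 = 0 :=
  haveI : Fact (Nat.Prime 3) := ⟨Nat.prime_three⟩
  shaCorank_eq_zero_of_forall _ 3 (forall_mem_sha_three_nsmul_eq_zero_of_gens_splitNodeKill S hS hout hgen hN0 hN hp hp1 hab
    hvb hvm w₀ hw₀ hw₀2 hw₀s hw₀9 hcert he₁ he₂ hgen₃)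

end CPMuDescent

end Literature.NumberTheory.EllipticCurves

end
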